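import Literature.NumberTheory.LFunctions.ConreyIwaniec2002Corollary63Large
import HarnessLib

/-!
# Conrey–Iwaniec (2002), the §1 currency forms `(log q)^{−67}` and Corollary 1.3 `(log q)^{−19}` from Proposition 8.1 alone

Conrey–Iwaniec, *Spacing of zeros of Hecke L-functions and the class number problem*, Acta Arith.
103 (2002) 259–312 [held text `paper:arxiv-math_0111012`], §1: the remark after Theorem 1.1
("Taking `A = 12` and `log T = (log q)^{18}` we get `L(1,χ) ≥ (log q)^{−66}` …") and Corollary 1.3.

WHY THIS FILE (cell landau-siegel/ls-inputs, K-INPUTS-5 = the `−(2A+7)` cascade of the booked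
finding F-S3/CI-(9.11); exponent map plan-1 ROWS-ADDENDUM-A2 §A2.4). The cascade is typed and
proved in `ConreyIwaniec2002ThmOneOneWeak.lean` MODULO the typed Proposition 9.1
(`conreyIwaniec2002_theorem11_weak_of_proposition91`, `lOne_ge_log_pow_neg_67_of_theorem11_weak`,
`conreyIwaniec2002_corollary13_odd_weak_of_proposition91`) and the `ψ = 1` Dedekind door in
`DedekindCloseZeroHypothesisWeak.lean`. Since then the Conrey–Iwaniec fact boundary MOVED: with
Corollary 6.3 proved in the large range (`ConreyIwaniec2002Corollary63Large.lean`) Theorem 1.1-weak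
(`−(2A+7)`), Corollary 10.2 (`−90`) and the Dedekind door (`−(4A+19)`,
`DedekindCloseZeroDoorOfProp81.lean`) all follow from the typed Proposition 8.1 ALONE, BY NAME. This
file adds the two remaining rows of the exponent map at that boundary, each a one-line composition
of tree theorems (nothing typed is re-worded; no new named fact; no `def`):

* `ConreyIwaniec2002.lOne_ge_log_pow_neg_67_of_prop81_large`,
  `lOne_ge_log_pow_neg_67_of_proposition81` — `L(1,χ) ≥ (log q)^{−67}` (odd `q`, the printed
  proviso `D(α,T) ≥ α^{−1} c T (log T)^{1/3}` at `log T = (log q)^{18}`) from Proposition 8.1 in the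
  range of its printed proof (`q^65 ≤ T`, `e^{(log q)²} ≤ T`), resp. from the typed
  `conreyIwaniec2002_proposition81`;
* `ConreyIwaniec2002.corollary13_odd_weak_of_prop81_large`,
  `conreyIwaniec2002_corollary13_odd_weak_of_proposition81` — Corollary 1.3 for odd `q` with
  `c′ (log q)^{−19}` from the same.

Exponent map realised by name from Proposition 8.1: Thm 1.1 `−(2A+7)` (tree), `−67` (here),
Cor 1.3 `−19` (here), Dedekind door `−(4A+19)` (tree), Cor 10.2 / Thm 1.2 `−90` (tree, unchanged).
Scope: `q` odd throughout (§7 of the source). NOT RH-BEARING; no claim about exceptional characters;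
no Landau–Siegel statement is proved by this file.

«The programme SEARCHES and TYPES; no claim about Landau–Siegel zeros, Theorems 1–2 of
arXiv:2211.02515 or a repaired Margin232 until a kernel theorem says so.»

## References
* [ConreyIwaniec2002] B. Conrey, H. Iwaniec, Acta Arith. 103 (2002) 259–312, arXiv:math/0111012:
  Theorem 1.1 (1.20)–(1.21) and the remark after it (p. 2); Corollary 1.3; Proposition 8.1 (8.10);
  Proposition 10.1.
-/

noncomputable section

open scoped NumberField
open Complex

namespace Literature.NumberTheory.LFunctions

namespace ConreyIwaniec2002

open NumberField

/-! ### From Proposition 8.1 in the range of its printed proof (`q^65 ≤ T`, `e^{(log q)²} ≤ T`) -/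

/-- **`L(1,χ) ≥ (log q)^{−67}` (odd `q`) FROM PROPOSITION 8.1 (`_large`) ALONE**: the printed remark
"Taking `A = 12` and `log T = (log q)^{18}` … provided `D(α,T) ≥ α^{−1} c T (log T)^{1/3}`", run on
Theorem 1.1-weak (`−(2A+7)`, tree `lOne_ge_log_pow_neg_67_of_theorem11_weak`), with Theorem 1.1-weak
taken from the Proposition 8.1 binder of its printed range (tree `theorem11_weak_of_prop81_large`).
Conclusion VERBATIM that of `lOne_ge_log_pow_neg_67_of_theorem11_weak`.
[cite: ConreyIwaniec2002, Theorem 1.1 (p. 2, remark after (1.21))] -/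
theorem lOne_ge_log_pow_neg_67_of_prop81_large
    (h81 : ∃ C : ℝ, 0 < C ∧
      ∀ (q : ℕ) [NeZero q], 4 < q → Odd q → ∀ χ : DirichletCharacter ℂ q,
        χ.IsPrimitive → χ.IsQuadratic → χ.Odd →
          ∀ (K : Type) [Field K] [NumberField K],
            Module.finrank ℚ K = 2 → NumberField.discr K = -(q : ℤ) →
              ∀ (ψ : ClassGroup (𝓞 K) →* ℂˣ) (T : ℝ) (S : Finset ℝ) (t' : ℝ → ℝ),
                (q : ℝ) ^ (65 : ℕ) ≤ T → Real.exp (Real.log q ^ (2 : ℕ)) ≤ T →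
                  IsDyadicPointSet S T →
                  defectD K ψ q S t' ≤
                    C * (T * Real.log q ^ (7 : ℕ) + T * calL χ T * Real.log T ^ (4 : ℕ))) :
    ∃ c : ℝ, 0 < c ∧
      ∀ (q : ℕ) [NeZero q], 4 < q → Odd q → ∀ χ : DirichletCharacter ℂ q,
        χ.IsPrimitive → χ.IsQuadratic → χ.Odd →
          ∀ (K : Type) [Field K] [NumberField K],
            Module.finrank ℚ K = 2 → NumberField.discr K = -(q : ℤ) →
              ∀ (ψ : ClassGroup (𝓞 K) →* ℂˣ) (T α : ℝ), 2 ≤ T → 0 < α → α ≤ 1 →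
                Real.log T = Real.log q ^ (18 : ℝ) →
                  α⁻¹ * c * T * Real.log T ^ ((1 : ℝ) / 3) ≤
                      (closeZeroCount (classGroupLFunction K ψ) α T : ℝ) →
                    Real.log q ^ (-(67 : ℝ)) ≤ ‖χ.LFunction 1‖ :=
  lOne_ge_log_pow_neg_67_of_theorem11_weak (theorem11_weak_of_prop81_large h81)

/-- **COROLLARY 1.3 FOR ODD `q` WITH `c′ (log q)^{−19}` FROM PROPOSITION 8.1 (`_large`) ALONE**:
"Let `S` be a set of points `½ + it` with `|t| ≤ T`, `|t − t′| ≥ 1`, `log T = (log q)^6`,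
`|L′(½+it)| ≤ (log q)^3`, `R ≫ T`; then `L(1,χ) ≫ (log q)^{−18}`" — here with the derivative bound
`(log q)^{7/2}` and the conclusion `c′ (log q)^{−19}` of the weak Proposition 10.1 (tree
`corollary13_odd_weak_of_proposition101_weak`), the weak Proposition 10.1 being taken from the
Proposition 8.1 binder of its printed range through Proposition 9.1 (`_large`), the `(log q)^{7/2}`
principal estimate and §10 (tree `prop91_large_of_prop81_large`, `principalEstimate_of`,
`proposition101_weak_of_principalEstimate_weak`). Conclusion VERBATIM that of
`conreyIwaniec2002_corollary13_odd_weak_of_proposition91`.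
[cite: ConreyIwaniec2002, Corollary 1.3] -/
theorem corollary13_odd_weak_of_prop81_large
    (h81 : ∃ C : ℝ, 0 < C ∧
      ∀ (q : ℕ) [NeZero q], 4 < q → Odd q → ∀ χ : DirichletCharacter ℂ q,
        χ.IsPrimitive → χ.IsQuadratic → χ.Odd →
          ∀ (K : Type) [Field K] [NumberField K],
            Module.finrank ℚ K = 2 → NumberField.discr K = -(q : ℤ) →
              ∀ (ψ : ClassGroup (𝓞 K) →* ℂˣ) (T : ℝ) (S : Finset ℝ) (t' : ℝ → ℝ),
                (q : ℝ) ^ (65 : ℕ) ≤ T → Real.exp (Real.log q ^ (2 : ℕ)) ≤ T →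
                  IsDyadicPointSet S T →
                  defectD K ψ q S t' ≤
                    C * (T * Real.log q ^ (7 : ℕ) + T * calL χ T * Real.log T ^ (4 : ℕ))) :
    ∃ c₁ : ℝ, 0 < c₁ ∧ ∃ c' : ℝ, 0 < c' ∧
      ∀ (q : ℕ) [NeZero q], 4 < q → Odd q → ∀ χ : DirichletCharacter ℂ q,
        χ.IsPrimitive → χ.IsQuadratic → χ.Odd →
          ∀ (K : Type) [Field K] [NumberField K],
            Module.finrank ℚ K = 2 → NumberField.discr K = -(q : ℤ) →
              ∀ (ψ : ClassGroup (𝓞 K) →* ℂˣ) (S : Finset ℝ),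
                IsPointSet S (Real.exp (Real.log q ^ (6 : ℕ))) →
                  (∀ t ∈ S, ‖deriv (classGroupLFunction K ψ) (1 / 2 + t * I)‖ ≤
                      Real.log q ^ ((7 : ℝ) / 2)) →
                    c₁ * Real.exp (Real.log q ^ (6 : ℕ)) ≤ (S.card : ℝ) →
                      c' * Real.log q ^ (-(19 : ℝ)) ≤ ‖χ.LFunction 1‖ :=
  corollary13_odd_weak_of_proposition101_weak
    (proposition101_weak_of_principalEstimate_weak
      (principalEstimate_of ((7 : ℝ) / 2) (prop91_large_of_prop81_large h81) calL_le_of_small_weak))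

end ConreyIwaniec2002

open ConreyIwaniec2002 NumberField

/-! ### Tree edges of record from the typed Proposition 8.1 -/

/-- **TYPED PROPOSITION 8.1 ⟹ `L(1,χ) ≥ (log q)^{−67}`** (odd `q`; the printed "`A = 12`,
`log T = (log q)^{18}`" specialisation of Theorem 1.1, weak exponent `67`; printed `66` needs the
unlocated claim of (9.11)). Corollary 6.3 DISCHARGED in the large range; no Siegel-type input.
[cite: ConreyIwaniec2002, Theorem 1.1 (p. 2, remark after (1.21))] -/
theorem lOne_ge_log_pow_neg_67_of_proposition81 (h81 : conreyIwaniec2002_proposition81) :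
    ∃ c : ℝ, 0 < c ∧
      ∀ (q : ℕ) [NeZero q], 4 < q → Odd q → ∀ χ : DirichletCharacter ℂ q,
        χ.IsPrimitive → χ.IsQuadratic → χ.Odd →
          ∀ (K : Type) [Field K] [NumberField K],
            Module.finrank ℚ K = 2 → NumberField.discr K = -(q : ℤ) →
              ∀ (ψ : ClassGroup (𝓞 K) →* ℂˣ) (T α : ℝ), 2 ≤ T → 0 < α → α ≤ 1 →
                Real.log T = Real.log q ^ (18 : ℝ) →
                  α⁻¹ * c * T * Real.log T ^ ((1 : ℝ) / 3) ≤
                      (closeZeroCount (classGroupLFunction K ψ) α T : ℝ) →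
                    Real.log q ^ (-(67 : ℝ)) ≤ ‖χ.LFunction 1‖ :=
  lOne_ge_log_pow_neg_67_of_prop81_large (prop81_large_of_proposition81 h81)

/-- **TYPED PROPOSITION 8.1 ⟹ COROLLARY 1.3 FOR ODD `q` WITH `c′ (log q)^{−19}`** (printed `−18`
needs the unlocated claim of (9.11)). Corollary 6.3 DISCHARGED in the large range; no Siegel-type
input. [cite: ConreyIwaniec2002, Corollary 1.3] -/
theorem conreyIwaniec2002_corollary13_odd_weak_of_proposition81
    (h81 : conreyIwaniec2002_proposition81) :
    ∃ c₁ : ℝ, 0 < c₁ ∧ ∃ c' : ℝ, 0 < c' ∧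
      ∀ (q : ℕ) [NeZero q], 4 < q → Odd q → ∀ χ : DirichletCharacter ℂ q,
        χ.IsPrimitive → χ.IsQuadratic → χ.Odd →
          ∀ (K : Type) [Field K] [NumberField K],
            Module.finrank ℚ K = 2 → NumberField.discr K = -(q : ℤ) →
              ∀ (ψ : ClassGroup (𝓞 K) →* ℂˣ) (S : Finset ℝ),
                IsPointSet S (Real.exp (Real.log q ^ (6 : ℕ))) →
                  (∀ t ∈ S, ‖deriv (classGroupLFunction K ψ) (1 / 2 + t * I)‖ ≤
                      Real.log q ^ ((7 : ℝ) / 2)) →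
                    c₁ * Real.exp (Real.log q ^ (6 : ℕ)) ≤ (S.card : ℝ) →
                      c' * Real.log q ^ (-(19 : ℝ)) ≤ ‖χ.LFunction 1‖ :=
  corollary13_odd_weak_of_prop81_large (prop81_large_of_proposition81 h81)

end Literature.NumberTheory.LFunctions

end
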